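/-
Copyright (c) 2026 the pub-hodgecm-mathlib formalisation cell (harness21).  Prover seat hodgecm-mathlib-K2E3-p23 (g6), HCML Track B «K2-LIT» ∕ h413
(`stmt-HodgeConjecture-24833`), line `K2_E3_EllipticInputs`, road «GL₂-sc» (road owner K2E5-p17 (g5), dealer K2E3-plan (g4)), NON-ELLIPTIC half, brick 2N-1:
the `Fin 2` twin of ★ T18-split `K2E3GL3TruncatedCharSplitTorusRadius` (K2E3-p14 (g5)) — HARISH-CHANDRA'S THEOREM 18 AT THE SPLIT CARTAN OF `GL₂`:
`x t x⁻¹ ∈ 𝔅_s`, `|D♮(t)| ≥ q^{−L}` ⇒ `x · a ∈ 𝔅_{2s+L}` for some `a ∈ A`.  2026-09-04.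
-/
import Summits.HodgeConjecture.HodgeConjecture.Theorems.K2E3GL3TruncatedCharSplitTorusRadius   -- ★ T18-split (K2E3-p14 g5): GENERIC §1 (Lagrange identity, eigenvalue bounds) and generic `v_eigenvalue_le_one_of_conj`, `v_pow_mul_eigenvalue_inv_le_one_of_conj`, `v_apply_mul_delta_mul_inv_apply_le_one`
import HarnessLib

/-!
# Road «GL₂-sc», non-elliptic half, brick 2N-1 — Theorem 18 at the split Cartan of `GL₂`: the conjugator of a split regular class has controlled height

Cell `pub/hodgecm-mathlib` (D-0151), Track B «K2-LIT», crux H413 = `stmt-HodgeConjecture-24833`, route of record `HCCMUnconditional`.  Lane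
`--supports stmt-HodgeConjecture-24833 --as helper`; THEOREMS ONLY (no `def`, no `instance`, no `notation`, no named-fact hypothesis, no `sorry`); count-neutral.
`Fin 2` reading of ★ T18-split §2 (K2E3-p14 (g5), road «GL-[M6]-sc»); the generic §1 (Lagrange identity `x_{ik} · Δ_k · (x⁻¹)_{kl} = ((y − c₁)(y − c₂))_{il}`,
eigenvalue bounds) is IMPORTED.  Harish-Chandra's Theorem 18 [HarishChandra1970, Part VII §2 p. 69; Cor. p. 69; §3 p. 71 (ii)] at `GL₂`: for `t = diag(d₀, d₁)` and
`y = x t x⁻¹` integral with `ϖ^s y⁻¹` integral, the Lagrange identity with `c₁ = c₂ = d_{1−k}` gives `|δ · x_{ik} (x⁻¹)_{kl}| ≤ 1` with `δ = (d₀ − d₁)² = disc χ_t`;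
normalising the columns of `x` by `a = diag(ϖ^{e}) ∈ A` gives `x · a ∈ 𝔅_{2s+L}` whenever `|ϖ^L · d₀d₁| ≤ |δ|`, i.e. `|D♮(t)| ≥ q^{−L}` for the scale-invariant discriminant
`D♮ = (d₀ − d₁)² ∕ (d₀d₁) = tr² ∕ det − 4` (the exponent `2s` replaces the `6s` of `GL₃`: `|ϖ^{2s}| ≤ |d₀d₁|`).  In the currency of ★ `K2E3GLnAdHeightBalls`
(`𝔅_m(g) :≡ ∀ i j k l, |ϖ^m g_{ij} (g⁻¹)_{kl}| ≤ 1`, scale-invariant):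
* `v_disc_mul_apply_mul_inv_apply_le_one` — `|(d₀−d₁)² · x_{ik} (x⁻¹)_{kl}| ≤ 1` for integral `x t x⁻¹`;
* `adBall_mul_zpowDiagGL_of_conj_integral_of_colMax`, `exists_adBall_mul_zpowDiagGL_of_conj_integral` — the normalised form;
* **`exists_adBall_mul_zpowDiagGL_of_adBall_conj (hϖ) (hϖ0) (ht : ↑t = diagonal d) (hy : 𝔅_s(x t x⁻¹)) (hD : |ϖ^L · d₀d₁| ≤ |(d₀−d₁)²|) : ∃ e, 𝔅_{2s+L}(x · zpowDiagGL e)`**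
  — Theorem 18 AND its Corollary, scale-invariant form (the support input of T20₂ and the `y₀`-normalisation of the ball estimate 2N-5);
* `exists_depth_of_injective` — for `d` injective some depth `L` works.
HONEST LABEL: HC_CM is proved only modulo the 7 printed citations (2 remaining named inputs: hLiu418 = stmt-HodgeConjecture-24832, h413 =
stmt-HodgeConjecture-24833) until rung 0 closes; count-neutral helper; Theorem 18 for the SPLIT Cartan of `GL₂` only (there is no other non-elliptic Cartan at `N = 2`).

## References
* [HarishChandra1970] Harish-Chandra (notes by G. van Dijk), *Harmonic Analysis on Reductive p-adic Groups*, LNM 162 (1970), Part VII §2 Thm 18 + Cor. p. 69, §3 p. 71 (ii).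
* [Cartier1979] P. Cartier, *Representations of 𝔭-adic groups: a survey*, PSPM 33.1 (1979), §IV.1.
-/

open Set Function
open scoped MatrixGroups Pointwise WithZero Topology
open Matrix
open Literature.NumberTheory.Automorphic
open Summit.HodgeConjecture.HodgeConjecture.Cruxes.H413.K2E3GLnAdHeightBalls
open Summit.HodgeConjecture.HodgeConjecture.Cruxes.H413.K2E3GL3TruncatedCharSplitTorusRadius
  (apply_mul_mul_inv_apply_eq_of_forall_ne exists_apply_ne_zero_of_col v_mul_apply_le_one v_sub_smul_one_apply_le_one v_eigenvalue_le_one_of_conj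
    v_pow_mul_eigenvalue_inv_le_one_of_conj v_apply_mul_delta_mul_inv_apply_le_one)

set_option linter.dupNamespace false

noncomputable section

namespace Summit.HodgeConjecture.HodgeConjecture.Cruxes.H413.K2E3GL2TruncatedCharSplitTorusRadius

section Thm18

variable {F : Type*} [Field F] [Valued F ℤᵐ⁰]

/-- **`|δ · x_{ik} (x⁻¹)_{kl}| ≤ 1`** for an integral `y = x t x⁻¹`, `t = diag(d₀, d₁)`, with `δ = (d₀−d₁)²` — the Lagrange identity with `c₁ = c₂ = d_{1−k}`
(`(d_m − d_{1−k})² = 0` for the other index `m = 1 − k`, and `(d_k − d_{1−k})² = δ`). [cite: HarishChandra1970, Part VII §2 Theorem 18 p. 69] -/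
theorem v_disc_mul_apply_mul_inv_apply_le_one {t x : GL (Fin 2) F} {d : Fin 2 → F} (ht : (t : Matrix (Fin 2) (Fin 2) F) = Matrix.diagonal d)
    (hy : ∀ i j, Valued.v (((x * t * x⁻¹ : GL (Fin 2) F) : Matrix (Fin 2) (Fin 2) F) i j) ≤ 1) (i k l : Fin 2) :
    Valued.v ((d 0 - d 1) ^ 2 * ((x : Matrix (Fin 2) (Fin 2) F) i k * ((x⁻¹ : GL (Fin 2) F) : Matrix (Fin 2) (Fin 2) F) k l)) ≤ 1 := by
  have hd : ∀ j, Valued.v (d j) ≤ 1 := v_eigenvalue_le_one_of_conj ht hy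
  set X : Matrix (Fin 2) (Fin 2) F := (x : Matrix (Fin 2) (Fin 2) F) with hX
  set X' : Matrix (Fin 2) (Fin 2) F := ((x⁻¹ : GL (Fin 2) F) : Matrix (Fin 2) (Fin 2) F) with hX'
  have h2 : ∀ m : Fin 2, m = 0 ∨ m = 1 := by decide
  obtain rfl | rfl := h2 k
  · have hL := v_apply_mul_delta_mul_inv_apply_le_one ht hy 0 (hd 1) (hd 1) (fun m hm => by
      obtain rfl | rfl := h2 m
      · exact absurd rfl hm
      · rw [sub_self, zero_mul]) i l
    have heq : (d 0 - d 1) ^ 2 * (X i 0 * X' 0 l) = X i 0 * ((d 0 - d 1) * (d 0 - d 1)) * X' 0 l := by ring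
    rw [heq]
    exact hL
  · have hL := v_apply_mul_delta_mul_inv_apply_le_one ht hy 1 (hd 0) (hd 0) (fun m hm => by
      obtain rfl | rfl := h2 m
      · rw [sub_self, zero_mul]
      · exact absurd rfl hm) i l
    have heq : (d 0 - d 1) ^ 2 * (X i 1 * X' 1 l) = X i 1 * ((d 1 - d 0) * (d 1 - d 0)) * X' 1 l := by ring
    rw [heq]
    exact hL

/-- **THEOREM 18 AT THE SPLIT CARTAN OF `GL₂`, NORMALISED FORM WITH A PRESCRIBED NORMALISATION.**  If `y = x t x⁻¹` (`t = diag(d₀,d₁)`) is integral with `ϖ^s y⁻¹`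
integral and `|ϖ^L · d₀d₁| ≤ |(d₀−d₁)²|` (`|D♮(t)| ≥ q^{−L}`), then for ANY exponent vector `e` normalising the columns of `x` (`|x_{ik}| ≤ exp(e_k)` with equality attained
in each column) the element `a = diag(ϖ^{e})` has `x · a ∈ 𝔅_{2s+L}`. [cite: HarishChandra1970, Part VII §2 Theorem 18 p. 69, Corollary p. 69] -/
theorem adBall_mul_zpowDiagGL_of_conj_integral_of_colMax {ϖ : F} (hϖ : Valued.v ϖ = WithZero.exp (-1 : ℤ)) (hϖ0 : ϖ ≠ 0)
    {t x : GL (Fin 2) F} {d : Fin 2 → F} (ht : (t : Matrix (Fin 2) (Fin 2) F) = Matrix.diagonal d) {s L : ℕ}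
    (hy : ∀ i j, Valued.v (((x * t * x⁻¹ : GL (Fin 2) F) : Matrix (Fin 2) (Fin 2) F) i j) ≤ 1)
    (hy' : ∀ i j, Valued.v (ϖ ^ s * (((x * t * x⁻¹)⁻¹ : GL (Fin 2) F) : Matrix (Fin 2) (Fin 2) F) i j) ≤ 1)
    (hD : Valued.v (ϖ ^ L * (d 0 * d 1)) ≤ Valued.v ((d 0 - d 1) ^ 2))
    (e : Fin 2 → ℤ) (hle : ∀ i k, Valued.v ((x : Matrix (Fin 2) (Fin 2) F) i k) ≤ WithZero.exp (e k))
    (hex : ∀ k, ∃ i, Valued.v ((x : Matrix (Fin 2) (Fin 2) F) i k) = WithZero.exp (e k)) :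
    ∀ i j k l, Valued.v (ϖ ^ (2 * s + L) * (((x * zpowDiagGL (n := 2) hϖ0 e : GL (Fin 2) F) : Matrix (Fin 2) (Fin 2) F) i j *
      (((x * zpowDiagGL (n := 2) hϖ0 e)⁻¹ : GL (Fin 2) F) : Matrix (Fin 2) (Fin 2) F) k l)) ≤ 1 := by
  set X : Matrix (Fin 2) (Fin 2) F := (x : Matrix (Fin 2) (Fin 2) F) with hX
  set X' : Matrix (Fin 2) (Fin 2) F := ((x⁻¹ : GL (Fin 2) F) : Matrix (Fin 2) (Fin 2) F) with hX'
  -- the top entry of each column: `|X (i₀ k) k| = exp (e k)`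
  choose i₀ hγ using hex
  have hmax : ∀ k i, Valued.v (X i k) ≤ Valued.v (X (i₀ k) k) := fun k i => (hle i k).trans_eq (hγ k).symm
  have hve : ∀ k, Valued.v (ϖ ^ (e k)) = WithZero.exp (-e k) := fun k => by
    rw [map_zpow₀, hϖ, ← WithZero.exp_zsmul, smul_eq_mul, mul_neg, mul_one]
  have hve' : ∀ k, Valued.v (ϖ ^ (-e k)) = Valued.v (X (i₀ k) k) := fun k => by
    rw [map_zpow₀, hϖ, ← WithZero.exp_zsmul, smul_eq_mul, mul_neg, mul_one, neg_neg, hγ]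
  -- entries of `x a` and `(x a)⁻¹`
  have hxa : ∀ i j, ((x * zpowDiagGL (n := 2) hϖ0 e : GL (Fin 2) F) : Matrix (Fin 2) (Fin 2) F) i j = X i j * ϖ ^ (e j) := fun i j => by
    rw [Units.val_mul, coe_zpowDiagGL, Matrix.mul_diagonal]
  have hxa' : ∀ k l, (((x * zpowDiagGL (n := 2) hϖ0 e)⁻¹ : GL (Fin 2) F) : Matrix (Fin 2) (Fin 2) F) k l = ϖ ^ (-e k) * X' k l := fun k l => by
    rw [_root_.mul_inv_rev, ← zpowDiagGL_neg, Units.val_mul, coe_zpowDiagGL, Matrix.diagonal_mul, Pi.neg_apply]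
  -- `|ϖ^{2s+L}| ≤ |δ|`
  have hd' : ∀ j, Valued.v (ϖ ^ s) ≤ Valued.v (d j) := by
    intro j
    have h1 := v_pow_mul_eigenvalue_inv_le_one_of_conj ht hy' j
    have hdj0 : d j ≠ 0 := by
      intro h0
      have hdet : ((t * t⁻¹ : GL (Fin 2) F) : Matrix (Fin 2) (Fin 2) F) j j = 1 := by rw [mul_inv_cancel, Units.val_one, Matrix.one_apply_eq]
      rw [Units.val_mul, ht, Matrix.diagonal_mul, h0, zero_mul] at hdet
      exact zero_ne_one hdet
    calc Valued.v (ϖ ^ s) = Valued.v (ϖ ^ s * (d j)⁻¹) * Valued.v (d j) := by rw [← map_mul, inv_mul_cancel_right₀ hdj0]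
      _ ≤ 1 * Valued.v (d j) := mul_le_mul_left h1 _
      _ = Valued.v (d j) := one_mul _
  have hϖδ : Valued.v (ϖ ^ (2 * s + L)) ≤ Valued.v ((d 0 - d 1) ^ 2) := by
    have h2s : Valued.v (ϖ ^ (2 * s)) ≤ Valued.v (d 0 * d 1) := by
      have heq : ϖ ^ (2 * s) = ϖ ^ s * ϖ ^ s := by ring
      rw [heq, map_mul, map_mul]
      exact mul_le_mul' (hd' 0) (hd' 1)
    calc Valued.v (ϖ ^ (2 * s + L)) = Valued.v (ϖ ^ L) * Valued.v (ϖ ^ (2 * s)) := by rw [pow_add, map_mul, mul_comm]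
      _ ≤ Valued.v (ϖ ^ L) * Valued.v (d 0 * d 1) := mul_le_mul_right h2s _
      _ = Valued.v (ϖ ^ L * (d 0 * d 1)) := (map_mul _ _ _).symm
      _ ≤ Valued.v ((d 0 - d 1) ^ 2) := hD
  intro i j k l
  rw [hxa, hxa']
  have heq : ϖ ^ (2 * s + L) * (X i j * ϖ ^ e j * (ϖ ^ (-e k) * X' k l)) = (X i j * ϖ ^ e j) * (ϖ ^ (2 * s + L) * (ϖ ^ (-e k) * X' k l)) := by ring
  rw [heq, map_mul]
  refine mul_le_one' ?_ ?_
  · rw [map_mul, hve j]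
    calc Valued.v (X i j) * WithZero.exp (-e j) ≤ WithZero.exp (e j) * WithZero.exp (-e j) := mul_le_mul_left ((hmax j i).trans_eq (hγ j)) _
      _ = 1 := by rw [← WithZero.exp_add, add_neg_cancel, WithZero.exp_zero]
  · rw [map_mul, map_mul, hve' k, ← map_mul, ← map_mul]
    calc Valued.v (ϖ ^ (2 * s + L) * (X (i₀ k) k * X' k l)) = Valued.v (ϖ ^ (2 * s + L)) * Valued.v (X (i₀ k) k * X' k l) := map_mul _ _ _
      _ ≤ Valued.v ((d 0 - d 1) ^ 2) * Valued.v (X (i₀ k) k * X' k l) := mul_le_mul_left hϖδ _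
      _ = Valued.v ((d 0 - d 1) ^ 2 * (X (i₀ k) k * X' k l)) := (map_mul _ _ _).symm
      _ ≤ 1 := v_disc_mul_apply_mul_inv_apply_le_one ht hy (i₀ k) k l

/-- **THEOREM 18 AT THE SPLIT CARTAN OF `GL₂`, NORMALISED FORM**: under the hypotheses of `adBall_mul_zpowDiagGL_of_conj_integral_of_colMax`, SOME `a = diag(ϖ^{e})`
(column maxima: `e_k = log max_i |x_{ik}|`) has `x · a ∈ 𝔅_{2s+L}`. [cite: HarishChandra1970, Part VII §2 Theorem 18 p. 69, Corollary p. 69] -/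
theorem exists_adBall_mul_zpowDiagGL_of_conj_integral {ϖ : F} (hϖ : Valued.v ϖ = WithZero.exp (-1 : ℤ)) (hϖ0 : ϖ ≠ 0)
    {t x : GL (Fin 2) F} {d : Fin 2 → F} (ht : (t : Matrix (Fin 2) (Fin 2) F) = Matrix.diagonal d) {s L : ℕ}
    (hy : ∀ i j, Valued.v (((x * t * x⁻¹ : GL (Fin 2) F) : Matrix (Fin 2) (Fin 2) F) i j) ≤ 1)
    (hy' : ∀ i j, Valued.v (ϖ ^ s * (((x * t * x⁻¹)⁻¹ : GL (Fin 2) F) : Matrix (Fin 2) (Fin 2) F) i j) ≤ 1)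
    (hD : Valued.v (ϖ ^ L * (d 0 * d 1)) ≤ Valued.v ((d 0 - d 1) ^ 2)) :
    ∃ e : Fin 2 → ℤ, ∀ i j k l, Valued.v (ϖ ^ (2 * s + L) * (((x * zpowDiagGL (n := 2) hϖ0 e : GL (Fin 2) F) : Matrix (Fin 2) (Fin 2) F) i j *
      (((x * zpowDiagGL (n := 2) hϖ0 e)⁻¹ : GL (Fin 2) F) : Matrix (Fin 2) (Fin 2) F) k l)) ≤ 1 := by
  have hcol : ∀ k : Fin 2, ∃ i₀ : Fin 2, (∀ i, Valued.v ((x : Matrix (Fin 2) (Fin 2) F) i k) ≤ Valued.v ((x : Matrix (Fin 2) (Fin 2) F) i₀ k)) ∧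
      Valued.v ((x : Matrix (Fin 2) (Fin 2) F) i₀ k) ≠ 0 := by
    intro k
    obtain ⟨i₁, hi₁⟩ := exists_apply_ne_zero_of_col x k
    obtain ⟨i₀, -, hi₀⟩ := Finset.exists_max_image (Finset.univ : Finset (Fin 2)) (fun i => Valued.v ((x : Matrix (Fin 2) (Fin 2) F) i k)) ⟨i₁, Finset.mem_univ _⟩
    refine ⟨i₀, fun i => hi₀ i (Finset.mem_univ _), fun h0 => ?_⟩
    have h1 := hi₀ i₁ (Finset.mem_univ _)
    rw [h0, le_zero_iff] at h1
    exact hi₁ ((Valuation.zero_iff _).1 h1)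
  choose i₀ hmax hne using hcol
  refine ⟨fun k => WithZero.log (Valued.v ((x : Matrix (Fin 2) (Fin 2) F) (i₀ k) k)),
    adBall_mul_zpowDiagGL_of_conj_integral_of_colMax hϖ hϖ0 ht hy hy' hD _ (fun i k => ?_) (fun k => ⟨i₀ k, (WithZero.exp_log (hne k)).symm⟩)⟩
  rw [WithZero.exp_log (hne k)]
  exact hmax k i

/-- **THEOREM 18 AT THE SPLIT CARTAN OF `GL₂`, SCALE-INVARIANT FORM** (Harish-Chandra's Theorem 18 AND its Corollary, explicit exponent).  For `t = diag(d)` and any `x`: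
if `x t x⁻¹ ∈ 𝔅_s` and `|ϖ^L · d₀d₁| ≤ |(d₀−d₁)²|` (`|D♮(t)| ≥ q^{−L}`; this encodes regularity), then `x · a ∈ 𝔅_{2s+L}` for some `a = diag(ϖ^{e}) ∈ A`.  Used with
`s := R₀` (`tsupport θ ⊆ Ω R₀`) it is the support input of Theorem 20 at `GL₂`; with `s := σ(x t x⁻¹)` it is the `y₀`-normalisation of p. 71 (ii).
[cite: HarishChandra1970, Part VII §2 Theorem 18 p. 69, Corollary p. 69; §3 p. 71 (ii)] -/
theorem exists_adBall_mul_zpowDiagGL_of_adBall_conj {ϖ : F} (hϖ : Valued.v ϖ = WithZero.exp (-1 : ℤ)) (hϖ0 : ϖ ≠ 0)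
    {t x : GL (Fin 2) F} {d : Fin 2 → F} (ht : (t : Matrix (Fin 2) (Fin 2) F) = Matrix.diagonal d) {s L : ℕ}
    (hy : ∀ i j k l, Valued.v (ϖ ^ s * (((x * t * x⁻¹ : GL (Fin 2) F) : Matrix (Fin 2) (Fin 2) F) i j *
      (((x * t * x⁻¹)⁻¹ : GL (Fin 2) F) : Matrix (Fin 2) (Fin 2) F) k l)) ≤ 1)
    (hD : Valued.v (ϖ ^ L * (d 0 * d 1)) ≤ Valued.v ((d 0 - d 1) ^ 2)) :
    ∃ e : Fin 2 → ℤ, ∀ i j k l, Valued.v (ϖ ^ (2 * s + L) * (((x * zpowDiagGL (n := 2) hϖ0 e : GL (Fin 2) F) : Matrix (Fin 2) (Fin 2) F) i j *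
      (((x * zpowDiagGL (n := 2) hϖ0 e)⁻¹ : GL (Fin 2) F) : Matrix (Fin 2) (Fin 2) F) k l)) ≤ 1 := by
  -- rescale `y = x t x⁻¹` and `t` together by `c = ϖ^{k₀}`
  obtain ⟨k₀, hk, hk'⟩ := exists_zpow_scalar_mul_integral_of_adBall hϖ hϖ0 hy
  set c : Fˣ := Units.mk0 ϖ hϖ0 ^ k₀ with hc
  set t' : GL (Fin 2) F := Matrix.GeneralLinearGroup.scalar (Fin 2) c * t with ht'def
  have ht' : (t' : Matrix (Fin 2) (Fin 2) F) = Matrix.diagonal fun i => (c : F) * d i := by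
    rw [ht'def, Units.val_mul, Matrix.GeneralLinearGroup.coe_scalar, Matrix.scalar_apply, ht, Matrix.diagonal_mul_diagonal]
  have hconj : Matrix.GeneralLinearGroup.scalar (Fin 2) c * (x * t * x⁻¹) = x * t' * x⁻¹ := by
    rw [ht'def, ← mul_assoc, ← mul_assoc, Matrix.GeneralLinearGroup.scalar_commute, mul_assoc x]
  rw [hconj] at hk hk'
  have hD' : Valued.v (ϖ ^ L * ((c : F) * d 0 * ((c : F) * d 1))) ≤ Valued.v (((c : F) * d 0 - (c : F) * d 1) ^ 2) := by
    have h1 : ϖ ^ L * ((c : F) * d 0 * ((c : F) * d 1)) = (c : F) ^ 2 * (ϖ ^ L * (d 0 * d 1)) := by ring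
    have h2 : ((c : F) * d 0 - (c : F) * d 1) ^ 2 = (c : F) ^ 2 * ((d 0 - d 1) ^ 2) := by ring
    rw [h1, h2]
    exact (map_mul _ _ _).trans_le ((mul_le_mul_right hD _).trans_eq (map_mul _ _ _).symm)
  exact exists_adBall_mul_zpowDiagGL_of_conj_integral hϖ hϖ0 ht' hk hk' hD'

/-- **A DEPTH EXISTS FOR REGULAR `t`**: for `d` injective there is `L` with `|ϖ^L · d₀d₁| ≤ |(d₀−d₁)²|`. [cite: HarishChandra1970, Part VII §2 p. 69] -/
theorem exists_depth_of_injective {ϖ : F} (hϖ : Valued.v ϖ = WithZero.exp (-1 : ℤ)) {d : Fin 2 → F} (hd : Function.Injective d) :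
    ∃ L : ℕ, Valued.v (ϖ ^ L * (d 0 * d 1)) ≤ Valued.v ((d 0 - d 1) ^ 2) := by
  have hδ0 : (d 0 - d 1) ^ 2 ≠ 0 := by
    refine pow_ne_zero 2 ?_
    rw [sub_ne_zero]
    intro h
    exact absurd (hd h) (by decide)
  set P : F := d 0 * d 1 with hP
  set δ : F := (d 0 - d 1) ^ 2 with hδ
  obtain ⟨N, hN⟩ := exists_forall_v_pow_mul_le_one hϖ (P / δ)
  refine ⟨N, ?_⟩
  have h1 := hN N le_rfl
  calc Valued.v (ϖ ^ N * P) = Valued.v (ϖ ^ N * (P / δ) * δ) := by rw [mul_assoc, div_mul_cancel₀ P hδ0]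
    _ = Valued.v (ϖ ^ N * (P / δ)) * Valued.v δ := map_mul _ _ _
    _ ≤ 1 * Valued.v δ := mul_le_mul_left h1 _
    _ = Valued.v δ := one_mul _

end Thm18

end Summit.HodgeConjecture.HodgeConjecture.Cruxes.H413.K2E3GL2TruncatedCharSplitTorusRadius

end
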